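import Literature.Geometry.Lorentzian.CarterThresholdRate
import HarnessLib

/-!
# The far turning point of the threshold barrier: location, and affine two-sided control of Carter's
# coefficient next to it (radial variable)
(namespace `Literature.Geometry.Lorentzian.Kerr`.)

Carter's radial equation at the superradiant threshold `ω = mω₊ ≠ 0` of a sub-extremal Kerr exterior,
barrier coefficient `q = V − ω²` with the exact profile `(r² + a²)²q = Δ·J + W₁`,
`J(r) = Λ′ − ω²(r + r₊)²h(r)`, `h = (r − r₊)/(r − r₋)`, `0 ≤ W₁ ≤ 3Δ` (`CarterThresholdRate.lean`:
`sq_mul_negCoeff_mem_Icc_of_threshold`, `thresholdProfile_sub_ge/le/lt`). In a Breitenlohner–Freedman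
stable sector `4r₊²ω² < Λ′` (and with at most half a horizon radius between the horizons,
`r₊ − r₋ ≤ r₊/2`, automatic near extremality) the strictly decreasing profile `J` has exactly ONE zero
`r_t` (the `r`-form far turning point), bracketed explicitly, and the TRUE turning point `ρ b₂`
(`V(ρ b₂) = ω²`, from the census) sits just beyond it:

* `exists_thresholdProfile_zero` — there is `r_t` with `J(r_t) = 0`,
  `√Λ′/|ω| ≤ r_t + r₊ ≤ √(2Λ′)/|ω|`, `J > 0` on `(r₊, r_t)` and `J < 0` on `(r_t, ∞)`;
* `thresholdProfile_turningRadius_le` — if `V(r_b) = ω²` at some `r_b > r₊` then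
  `−3 ≤ J(r_b) ≤ 0`, hence `r_t ≤ r_b` and `2ω²(r_t + r₊)h(r_t)·(r_b − r_t) ≤ 3`
  (the true turning point is within `O(1/(|ω|√Λ′))` of `r_t`);
* `sq_mul_negCoeff_affine_bounds_of_threshold` — AFFINE two-sided control towards `r_b`: for every
  `r ∈ (r₊, r_b]`,
  `Δ(r)·(2ω²(r + r₊)h(r)·(r_t − r) − 3) ≤ (r² + a²)²q(r) ≤ Δ(r)·(ω²(2(r_t + r₊) + (r_t + r₊)²/(r − r₋))·(r_b − r) + 3)`
  (lower: `J(r) ≥ 2ω²(r + r₊)h(r)(r_t − r)` before `r_t` and `J ≥ −3` on `[r_t, r_b]`; upper: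
  `J(r) ≤ C·(r_t − r) ≤ C·(r_b − r)` before `r_t` and `J ≤ 0` after).

These radial statements are the input of the tortoise-variable affine bound
`c₁(b₂ − s) − e₁ ≤ q ≤ c₂(b₂ − s) + e₂` on the last stretch before `b₂` (via two-sided control of
`ρ′ = Δ/(ρ² + a²)` there), which feeds `TurningPointEndgame.norm_le_of_affine_coeff` and the depth
certification of the threshold tunnelling estimate (near-extremal Kerr programme, crux
`KappaExplicitWaveDecay`, BF-stable large-`Λ` kernel bound). Not here: that conversion, and anything
off the threshold.

## References
* M. Dafermos, I. Rodnianski, Y. Shlapentokh-Rothman, arXiv:1402.7034 = Ann. of Math. 183 (2016),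
  §§5.2.3, 6.2–6.4 (key `DafermosRodnianskiShlapentokhrothman2014`).
* R. Teixeira da Costa, Commun. Math. Phys. 378 (2020), §2.2 (key `Costa2019`). The assembly is folklore.
-/

noncomputable section

open Set

namespace Literature.Geometry.Lorentzian

namespace Kerr

section TurningPoint

variable {M a ω Λ : ℝ} {m : ℤ}

/-- The threshold profile is continuous on `(r₊, ∞)` (a rational function with poles at `r₋ < r₊`
only). [folklore] -/
private theorem continuousOn_thresholdProfile (ha : |a| < M) :
    ContinuousOn (fun r : ℝ ↦ Λ - 2 * a * m * ω -
      ω ^ 2 * (r + rPlus M a) ^ 2 * ((r - rPlus M a) / (r - rMinus M a))) (Ioi (rPlus M a)) := by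
  have hsub : IsSubextremal M a := ha
  refine ContinuousOn.sub continuousOn_const ?_
  refine ContinuousOn.mul (by fun_prop) ?_
  refine ContinuousOn.div (by fun_prop) (by fun_prop) fun r hr ↦ ?_
  have : rPlus M a < r := hr
  linarith [hsub.rMinus_lt_rPlus]

/-- **The `r`-form far turning point of the threshold barrier.** For `|a| < M`, `ω ≠ 0`,
`r₊ − r₋ ≤ r₊/2` and a Breitenlohner–Freedman stable sector `4r₊²ω² < Λ′` (`Λ′ = Λ − 2amω`): there is
`r_t > r₊` with `J(r_t) = 0`, `√Λ′/|ω| ≤ r_t + r₊ ≤ √(2Λ′)/|ω|`, `J(r) > 0` for `r₊ < r < r_t` and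
`J(r) < 0` for `r > r_t`, where `J(r) = Λ′ − ω²(r + r₊)²(r − r₊)/(r − r₋)`. Proof: `J ≥ Λ′ − ω²(r + r₊)² ≥ 0`
at `r + r₊ = √Λ′/|ω|` (`thresholdProfile_ge`), `J ≤ Λ′ − ½ω²(r + r₊)² ≤ 0` at `r + r₊ = √(2Λ′)/|ω|`
(`thresholdProfile_le`, this radius being `≥ r₊ + (r₊ − r₋)`), intermediate value theorem, and strict
monotonicity (`thresholdProfile_lt`). [folklore] -/
theorem exists_thresholdProfile_zero (ha : |a| < M) (hω : ω ≠ 0)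
    (hd : rPlus M a - rMinus M a ≤ rPlus M a / 2)
    (hBF : 4 * rPlus M a ^ 2 * ω ^ 2 < Λ - 2 * a * m * ω) :
    ∃ rt : ℝ, rPlus M a < rt ∧
      Real.sqrt (Λ - 2 * a * m * ω) / |ω| ≤ rt + rPlus M a ∧
      rt + rPlus M a ≤ Real.sqrt (2 * (Λ - 2 * a * m * ω)) / |ω| ∧
      Λ - 2 * a * m * ω - ω ^ 2 * (rt + rPlus M a) ^ 2 * ((rt - rPlus M a) / (rt - rMinus M a)) = 0 ∧
      (∀ r, rPlus M a < r → r < rt →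
        0 < Λ - 2 * a * m * ω - ω ^ 2 * (r + rPlus M a) ^ 2 * ((r - rPlus M a) / (r - rMinus M a))) ∧
      (∀ r, rt < r →
        Λ - 2 * a * m * ω - ω ^ 2 * (r + rPlus M a) ^ 2 * ((r - rPlus M a) / (r - rMinus M a)) < 0) := by
  have hM : 0 < M := lt_of_le_of_lt (abs_nonneg a) ha
  have hrp : 0 < rPlus M a := rPlus_pos hM a
  have hsub : IsSubextremal M a := ha
  have hω0 : 0 < |ω| := abs_pos.2 hω
  have hω2 : 0 < ω ^ 2 := by positivity
  set Λ' := Λ - 2 * a * m * ω with hΛ'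
  have hΛ'0 : 0 < Λ' := lt_of_le_of_lt (by positivity) hBF
  set J : ℝ → ℝ := fun r ↦ Λ' - ω ^ 2 * (r + rPlus M a) ^ 2 * ((r - rPlus M a) / (r - rMinus M a))
    with hJ
  -- the two bracketing radii
  set r₂ := Real.sqrt Λ' / |ω| - rPlus M a with hr₂
  set R₂ := Real.sqrt (2 * Λ') / |ω| - rPlus M a with hR₂
  have hsq1 : (Real.sqrt Λ' / |ω|) ^ 2 = Λ' / ω ^ 2 := by
    rw [div_pow, Real.sq_sqrt hΛ'0.le, sq_abs]
  have hsq2 : (Real.sqrt (2 * Λ') / |ω|) ^ 2 = 2 * Λ' / ω ^ 2 := by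
    rw [div_pow, Real.sq_sqrt (by positivity), sq_abs]
  -- `2r₊ < √Λ′/|ω|`
  have h2r : 2 * rPlus M a < Real.sqrt Λ' / |ω| := by
    have h1 : (2 * rPlus M a) ^ 2 < (Real.sqrt Λ' / |ω|) ^ 2 := by
      rw [hsq1, lt_div_iff₀ hω2]; nlinarith
    exact lt_of_pow_lt_pow_left₀ 2 (by positivity) h1
  have hr₂p : rPlus M a < r₂ := by rw [hr₂]; linarith
  -- `√Λ′/|ω| ≤ √(2Λ′)/|ω|` and `R₂ − r₊ ≥ r₊ − r₋`
  have hsqrt_le : Real.sqrt Λ' / |ω| ≤ Real.sqrt (2 * Λ') / |ω| :=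
    div_le_div_of_nonneg_right (Real.sqrt_le_sqrt (by linarith)) hω0.le
  have hsqrt2 : Real.sqrt 2 * (Real.sqrt Λ' / |ω|) = Real.sqrt (2 * Λ') / |ω| := by
    rw [Real.sqrt_mul (by norm_num : (0:ℝ) ≤ 2), mul_div_assoc]
  have hR₂d : rPlus M a - rMinus M a ≤ R₂ - rPlus M a := by
    -- `R₂ + r₊ = √2·√Λ′/|ω| ≥ √2·2r₊ ≥ 2r₊ + r₊/2`
    have hs2 : (1.25 : ℝ) ≤ Real.sqrt 2 := by
      rw [Real.le_sqrt (by norm_num) (by norm_num)]; norm_num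
    have h1 : Real.sqrt 2 * (2 * rPlus M a) ≤ Real.sqrt 2 * (Real.sqrt Λ' / |ω|) :=
      mul_le_mul_of_nonneg_left h2r.le (Real.sqrt_nonneg _)
    rw [hsqrt2] at h1
    rw [hR₂]
    nlinarith
  have hr₂R₂ : r₂ ≤ R₂ := by rw [hr₂, hR₂]; linarith
  -- signs at the two ends
  have hJr₂ : 0 ≤ J r₂ := by
    have h := thresholdProfile_ge (ω := ω) (Λ := Λ) (m := m) ha hr₂p
    have e : r₂ + rPlus M a = Real.sqrt Λ' / |ω| := by rw [hr₂]; ring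
    have h0 : Λ' - ω ^ 2 * (r₂ + rPlus M a) ^ 2 = 0 := by
      rw [e, hsq1]; field_simp; ring
    simp only [hJ]
    linarith
  have hJR₂ : J R₂ ≤ 0 := by
    have h := thresholdProfile_le (ω := ω) (Λ := Λ) (m := m) ha hR₂d
    have e : R₂ + rPlus M a = Real.sqrt (2 * Λ') / |ω| := by rw [hR₂]; ring
    have h0 : Λ' - ω ^ 2 * (R₂ + rPlus M a) ^ 2 / 2 = 0 := by
      rw [e, hsq2]; field_simp; ring
    simp only [hJ]
    linarith
  -- intermediate value theorem on `[r₂, R₂]`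
  have hcont : ContinuousOn J (Icc r₂ R₂) :=
    (continuousOn_thresholdProfile (ω := ω) (Λ := Λ) (m := m) ha).mono
      fun r hr ↦ lt_of_lt_of_le hr₂p hr.1
  have hivt : (0 : ℝ) ∈ J '' Icc r₂ R₂ := by
    have h := intermediate_value_Icc' hr₂R₂ hcont
    exact h ⟨hJR₂, hJr₂⟩
  obtain ⟨rt, hrt, hJrt⟩ := hivt
  have hrtp : rPlus M a < rt := lt_of_lt_of_le hr₂p hrt.1
  refine ⟨rt, hrtp, ?_, ?_, hJrt, fun r hr hrr ↦ ?_, fun r hr ↦ ?_⟩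
  · have : r₂ + rPlus M a = Real.sqrt Λ' / |ω| := by rw [hr₂]; ring
    linarith [hrt.1]
  · have : R₂ + rPlus M a = Real.sqrt (2 * Λ') / |ω| := by rw [hR₂]; ring
    linarith [hrt.2]
  · have h := thresholdProfile_lt (ω := ω) (Λ := Λ) (m := m) ha hω hr hrr
    simp only [hJ] at hJrt
    linarith
  · have h := thresholdProfile_lt (ω := ω) (Λ := Λ) (m := m) ha hω hrtp hr
    simp only [hJ] at hJrt
    linarith

/-- **The true turning point sits just beyond the `r`-form one.** At the threshold `ω = mω₊`
(`|a| < M`), if `V(r_b) = ω²` at a radius `r_b > r₊` and `J(r_t) = 0` at `r_t > r₊` with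
`r_t − r₊ ≥ r₊ − r₋`, then `−3 ≤ J(r_b) ≤ 0` (`0 = (r_b² + a²)²q(r_b) ∈ [Δ·J, Δ·(J + 3)]`, `Δ > 0`),
`r_t ≤ r_b`, and `ω²(r_t + r₊)·(r_b − r_t) ≤ 3` (linear lower bound of `J` from `r_t`, with
`h(r_t) ≥ ½`). [folklore] -/
theorem thresholdProfile_turningRadius_le (ha : |a| < M) (hωth : ω = m * horizonAngularVelocity M a)
    (hω : ω ≠ 0) {rt rb : ℝ} (hrt : rPlus M a < rt) (hrtd : rPlus M a - rMinus M a ≤ rt - rPlus M a)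
    (hJrt : Λ - 2 * a * m * ω - ω ^ 2 * (rt + rPlus M a) ^ 2 * ((rt - rPlus M a) / (rt - rMinus M a)) = 0)
    (hrb : rPlus M a < rb) (hV : sepPotential M a ω m Λ rb = ω ^ 2) :
    -3 ≤ Λ - 2 * a * m * ω - ω ^ 2 * (rb + rPlus M a) ^ 2 * ((rb - rPlus M a) / (rb - rMinus M a)) ∧
    Λ - 2 * a * m * ω - ω ^ 2 * (rb + rPlus M a) ^ 2 * ((rb - rPlus M a) / (rb - rMinus M a)) ≤ 0 ∧
    rt ≤ rb ∧ ω ^ 2 * (rt + rPlus M a) * (rb - rt) ≤ 3 := by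
  have hM : 0 < M := lt_of_le_of_lt (abs_nonneg a) ha
  have hrp : 0 < rPlus M a := rPlus_pos hM a
  have hsub : IsSubextremal M a := ha
  have hΔ : 0 < delta M a rb := delta_pos ha.le hrb
  obtain ⟨h1, h2⟩ := sq_mul_negCoeff_mem_Icc_of_threshold (Λ := Λ) ha hωth hrb
  rw [hV, sub_self, mul_zero] at h1 h2
  set Jb := Λ - 2 * a * m * ω - ω ^ 2 * (rb + rPlus M a) ^ 2 * ((rb - rPlus M a) / (rb - rMinus M a))
    with hJb
  have hJb0 : Jb ≤ 0 := by
    by_contra hcon; push Not at hcon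
    have : 0 < delta M a rb * Jb := mul_pos hΔ hcon
    linarith
  have hJb3 : -3 ≤ Jb := by
    by_contra hcon; push Not at hcon
    have : delta M a rb * (Jb + 3) < 0 := mul_neg_of_pos_of_neg hΔ (by linarith)
    linarith
  -- `r_t ≤ r_b` by strict monotonicity
  have hle : rt ≤ rb := by
    by_contra hcon; push Not at hcon
    have h := thresholdProfile_lt (ω := ω) (Λ := Λ) (m := m) ha hω hrb hcon
    rw [hJrt] at h
    exact absurd h (not_lt.2 hJb0)
  refine ⟨hJb3, hJb0, hle, ?_⟩
  -- linear lower bound from `r_t` to `r_b`, and `h(r_t) ≥ ½`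
  have hlin := thresholdProfile_sub_ge (ω := ω) (Λ := Λ) (m := m) ha hrt hle
  rw [hJrt] at hlin
  have hd0 : 0 < rPlus M a - rMinus M a := sub_pos.2 hsub.rMinus_lt_rPlus
  have hrtm : 0 < rt - rMinus M a := by linarith
  have hh : 1 / 2 ≤ (rt - rPlus M a) / (rt - rMinus M a) := by
    rw [le_div_iff₀ hrtm]; linarith
  have hpos : 0 ≤ ω ^ 2 * (rt + rPlus M a) * (rb - rt) :=
    mul_nonneg (mul_nonneg (sq_nonneg _) (by linarith)) (by linarith)
  -- `2ω²(rt+r₊)·h·(rb−rt) ≥ 2ω²(rt+r₊)·½·(rb−rt)`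
  have h3 : ω ^ 2 * (rt + rPlus M a) * (rb - rt) ≤
      2 * ω ^ 2 * (rt + rPlus M a) * ((rt - rPlus M a) / (rt - rMinus M a)) * (rb - rt) := by
    have := mul_le_mul_of_nonneg_left hh hpos
    calc ω ^ 2 * (rt + rPlus M a) * (rb - rt) = ω ^ 2 * (rt + rPlus M a) * (rb - rt) * (1 / 2) * 2 := by
          ring
      _ ≤ ω ^ 2 * (rt + rPlus M a) * (rb - rt) * ((rt - rPlus M a) / (rt - rMinus M a)) * 2 := by
          nlinarith
      _ = 2 * ω ^ 2 * (rt + rPlus M a) * ((rt - rPlus M a) / (rt - rMinus M a)) * (rb - rt) := by ring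
  linarith

/-- **Affine two-sided control of the barrier coefficient towards the true turning point.** At the
threshold `ω = mω₊ ≠ 0` (`|a| < M`), let `J(r_t) = 0` (`r_t > r₊`, `r_t − r₊ ≥ r₊ − r₋`) and
`V(r_b) = ω²` (`r_b > r₊`). Then for every `r ∈ (r₊, r_b]`:
`Δ(r)·(2ω²(r + r₊)h(r)·(r_t − r) − 3) ≤ (r² + a²)²(V(r) − ω²)` and
`(r² + a²)²(V(r) − ω²) ≤ Δ(r)·(ω²(2(r_t + r₊) + (r_t + r₊)²/(r − r₋))·(r_b − r) + 3)`. [folklore] -/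
theorem sq_mul_negCoeff_affine_bounds_of_threshold (ha : |a| < M)
    (hωth : ω = m * horizonAngularVelocity M a) (hω : ω ≠ 0) {rt rb : ℝ} (hrt : rPlus M a < rt)
    (hrtd : rPlus M a - rMinus M a ≤ rt - rPlus M a)
    (hJrt : Λ - 2 * a * m * ω - ω ^ 2 * (rt + rPlus M a) ^ 2 * ((rt - rPlus M a) / (rt - rMinus M a)) = 0)
    (hrb : rPlus M a < rb) (hV : sepPotential M a ω m Λ rb = ω ^ 2) {r : ℝ} (hr : rPlus M a < r)
    (hrrb : r ≤ rb) :
    delta M a r * (2 * ω ^ 2 * (r + rPlus M a) * ((r - rPlus M a) / (r - rMinus M a)) * (rt - r) - 3) ≤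
        (r ^ 2 + a ^ 2) ^ 2 * (sepPotential M a ω m Λ r - ω ^ 2) ∧
      (r ^ 2 + a ^ 2) ^ 2 * (sepPotential M a ω m Λ r - ω ^ 2) ≤
        delta M a r * (ω ^ 2 * (2 * (rt + rPlus M a) + (rt + rPlus M a) ^ 2 / (r - rMinus M a)) *
          (rb - r) + 3) := by
  have hM : 0 < M := lt_of_le_of_lt (abs_nonneg a) ha
  have hrp : 0 < rPlus M a := rPlus_pos hM a
  have hsub : IsSubextremal M a := ha
  have hΔ : 0 ≤ delta M a r := delta_nonneg ha.le hr.le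
  obtain ⟨hJb3, hJb0, hle, -⟩ := thresholdProfile_turningRadius_le (Λ := Λ) ha hωth hω hrt hrtd hJrt hrb hV
  obtain ⟨hlow, hup⟩ := sq_mul_negCoeff_mem_Icc_of_threshold (Λ := Λ) ha hωth hr
  set Jr := Λ - 2 * a * m * ω - ω ^ 2 * (r + rPlus M a) ^ 2 * ((r - rPlus M a) / (r - rMinus M a))
    with hJr
  have hrm : 0 < r - rMinus M a := by linarith [hsub.rMinus_lt_rPlus]
  have hhr : 0 ≤ (r - rPlus M a) / (r - rMinus M a) := div_nonneg (by linarith) hrm.le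
  have hcr : 0 ≤ 2 * ω ^ 2 * (r + rPlus M a) * ((r - rPlus M a) / (r - rMinus M a)) :=
    mul_nonneg (mul_nonneg (by positivity) (by linarith)) hhr
  have hCr : 0 ≤ ω ^ 2 * (2 * (rt + rPlus M a) + (rt + rPlus M a) ^ 2 / (r - rMinus M a)) := by
    have : 0 ≤ 2 * (rt + rPlus M a) + (rt + rPlus M a) ^ 2 / (r - rMinus M a) :=
      add_nonneg (by linarith) (div_nonneg (sq_nonneg _) hrm.le)
    exact mul_nonneg (sq_nonneg _) this
  constructor
  · -- lower: `J(r) ≥ 2ω²(r+r₊)h(r)(r_t − r) − 3`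
    have hJlow : 2 * ω ^ 2 * (r + rPlus M a) * ((r - rPlus M a) / (r - rMinus M a)) * (rt - r) - 3 ≤
        Jr := by
      rcases le_or_gt r rt with hrrt | hrtr
      · have h := thresholdProfile_sub_ge (ω := ω) (Λ := Λ) (m := m) ha hr hrrt
        rw [hJrt] at h
        simp only [hJr]; linarith
      · -- `r_t < r ≤ r_b`: `J(r) ≥ J(r_b) ≥ −3` and the linear term is `≤ 0`
        have h1 : Jr ≥ -3 := by
          rcases hrrb.eq_or_lt with h | h
          · rw [hJr, h]; exact hJb3
          · have := thresholdProfile_lt (ω := ω) (Λ := Λ) (m := m) ha hω hr h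
            simp only [hJr]; linarith
        have h2 : 2 * ω ^ 2 * (r + rPlus M a) * ((r - rPlus M a) / (r - rMinus M a)) * (rt - r) ≤ 0 :=
          mul_nonpos_of_nonneg_of_nonpos hcr (by linarith)
        linarith
    calc delta M a r * (2 * ω ^ 2 * (r + rPlus M a) * ((r - rPlus M a) / (r - rMinus M a)) *
          (rt - r) - 3) ≤ delta M a r * Jr := mul_le_mul_of_nonneg_left hJlow hΔ
      _ ≤ _ := hlow
  · -- upper: `J(r) ≤ C(r)(r_b − r)`
    have hJup : Jr ≤ ω ^ 2 * (2 * (rt + rPlus M a) + (rt + rPlus M a) ^ 2 / (r - rMinus M a)) *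
        (rb - r) := by
      rcases le_or_gt r rt with hrrt | hrtr
      · have h := thresholdProfile_sub_le (ω := ω) (Λ := Λ) (m := m) ha hr hrrt
        rw [hJrt] at h
        have h2 : ω ^ 2 * (2 * (rt + rPlus M a) + (rt + rPlus M a) ^ 2 / (r - rMinus M a)) * (rt - r) ≤
            ω ^ 2 * (2 * (rt + rPlus M a) + (rt + rPlus M a) ^ 2 / (r - rMinus M a)) * (rb - r) :=
          mul_le_mul_of_nonneg_left (by linarith) hCr
        simp only [hJr]; linarith
      · have h1 : Jr ≤ 0 := by
          have := thresholdProfile_lt (ω := ω) (Λ := Λ) (m := m) ha hω hrt hrtr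
          rw [hJrt] at this
          simp only [hJr]; linarith
        have h2 : 0 ≤ ω ^ 2 * (2 * (rt + rPlus M a) + (rt + rPlus M a) ^ 2 / (r - rMinus M a)) *
            (rb - r) := mul_nonneg hCr (by linarith)
        linarith
    calc (r ^ 2 + a ^ 2) ^ 2 * (sepPotential M a ω m Λ r - ω ^ 2) ≤ delta M a r * (Jr + 3) := hup
      _ ≤ _ := mul_le_mul_of_nonneg_left (by linarith) hΔ

end TurningPoint

end Kerr

end Literature.Geometry.Lorentzian

end
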